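import Mathlib.GroupTheory.FreeGroup.CyclicallyReduced
import Mathlib.GroupTheory.OrderOfElement
import Mathlib.Topology.Algebra.Group.Quotient
import Mathlib.Topology.Algebra.OpenSubgroup
import Literature.AnabelianGeometry.EtaleTheta.Conventions
import HarnessLib

/-!
# [EtTh] §0 p.9 / Def. 3.3 (i)(b): a CRITERION for the minimal co-free subgroup — compact subgroups die in
# every co-free quotient (proof-only; the mechanism behind `Δ^{fil,∞}_i`)

S. Mochizuki, *The étale theta function and its Frobenioid-theoretic manifestations*, Publ. RIMS **45** (2009)
[MochizukiEtTh2009], §0 p.235 (PDF p.9): "a normal open subgroup `H ⊆ G` such that `G/H` is a free discrete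
group as *co-free*; a co-free subgroup `H ⊆ G` as *minimal* if every co-free subgroup of `G` contains `H`";
Def. 3.3 (i)(b) p.298 (PDF p.72): "every `Δ^fil_i` admits a minimal co-free subgroup `Δ^{fil,∞}_i`"; Def. 3.3
(ii): `Δ^{fil,∞}_i` corresponds to the "universal combinatorial covering" `Z^log_∞ → Z^log` — i.e. it is the
kernel of `Π^tp_Z ↠ π₁(dual graph)`, the normal subgroup (topologically) generated by the COMPACT
decomposition groups of the irreducible components, with FREE discrete quotient ([SemiAnbd] Ex. 3.10 /
[EtTh] §1 p.253 "`Z^log_∞`").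

abc-iut cell, layer L2, NV-L2/TemperedFilter line (seat abc-iut-w5-d118; companion of
`Discharge/Sec3TemperedFilterWitness.lean`, p424847/p425653).  That file witnessed Def. 3.3 (i) in the two
EXTREME regimes `Δ^{fil,∞} = {1}` (discrete free groups) and `Δ^{fil,∞} = Δ^fil` (profinite groups).  This file
proves the general MECHANISM that produces `Δ^{fil,∞}` in between, exactly as in print:

* `le_of_isCofree_of_isCompact` — **a COMPACT subgroup of a topological group lies in every co-free subgroup**
  (its image in the discrete free quotient is a finite subgroup of a torsion-free group, hence trivial);
* `isMinimalCofree_of_isCompact` — a co-free subgroup which is compact is THE minimal co-free subgroup;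
* `isMinimalCofree_of_le_topologicalClosure_iSup` — more generally, a co-free subgroup contained in the closed
  normal hull of a family of compact subgroups (e.g. topologically generated by compact "vertex/decomposition
  groups") is the minimal co-free subgroup;
* `isMinimalCofree_prod_top_bot` — the model case of a product `P × L` of a COMPACT group `P` and a DISCRETE
  FREE group `L` (the shape `Ẑ(1) × ℤ` of the geometric tempered fundamental group of a Tate curve, [EtTh]
  §1): the minimal co-free subgroup is the compact factor `P × {1}` — strictly between `{1}` and the whole group.

HONEST FRAMING: plain topological group theory; refereed pre-IUT material ([EtTh] §0/§3); nothing here bears on,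
or takes a side on, [IUTchIII] Cor. 3.12; typed ≠ proved.
-/

namespace Literature.AnabelianGeometry.EtaleTheta

universe u

open Topology

section Criterion

variable {H : Type u} [Group H] [TopologicalSpace H] [IsTopologicalGroup H]

/-- A free group has no non-trivial element of finite order (Mathlib: `FreeGroup` is torsion-free, transported
along `IsFreeGroup.toFreeGroup`). [cite: MochizukiEtTh2009, §0 p.9] -/
theorem eq_one_of_isOfFinOrder_of_isFreeGroup {F : Type u} [Group F] [IsFreeGroup F] {x : F}
    (hx : IsOfFinOrder x) : x = 1 := by
  have h := (MonoidHom.isOfFinOrder (IsFreeGroup.toFreeGroup F).toMonoidHom hx).eq_one'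
  exact (IsFreeGroup.toFreeGroup F).injective (by simpa using h)

/-- **A compact subgroup lies in every co-free subgroup**: if `N ⊴ H` is co-free (open with `H/N` free) and
`K ⊆ H` is compact, then `K ⊆ N` — the image of `K` in the DISCRETE group `H/N` is compact, hence a finite
subgroup of a free (torsion-free) group, hence trivial. [cite: MochizukiEtTh2009, §0 p.9] -/
theorem le_of_isCofree_of_isCompact {N : Subgroup H} [N.Normal] (hN : IsCofree N) (K : Subgroup H)
    (hK : IsCompact (K : Set H)) : K ≤ N := by
  haveI : DiscreteTopology (H ⧸ N) := QuotientGroup.discreteTopology hN.isOpen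
  haveI := hN.isFreeGroup_quotient
  -- the image of `K` in `H/N` is a finite subgroup
  have hfin : ((K.map (QuotientGroup.mk' N) : Subgroup (H ⧸ N)) : Set (H ⧸ N)).Finite := by
    rw [Subgroup.coe_map]
    exact (hK.image continuous_quotient_mk').finite_of_discrete
  haveI : Finite (K.map (QuotientGroup.mk' N)) := Set.finite_coe_iff.mpr hfin
  intro k hk
  have hmem : (QuotientGroup.mk' N k) ∈ K.map (QuotientGroup.mk' N) := Subgroup.mem_map_of_mem _ hk
  have hfo : IsOfFinOrder (⟨_, hmem⟩ : K.map (QuotientGroup.mk' N)) := isOfFinOrder_of_finite _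
  have hfo' : IsOfFinOrder (QuotientGroup.mk' N k) := by
    simpa using MonoidHom.isOfFinOrder (K.map (QuotientGroup.mk' N)).subtype hfo
  exact (QuotientGroup.eq_one_iff k).mp (eq_one_of_isOfFinOrder_of_isFreeGroup hfo')

/-- **Criterion**: a co-free subgroup `C ⊴ H` which is COMPACT is the minimal co-free subgroup of `H`.
(Both extreme cases are instances: `C = {1}` in a discrete free group, `C = H` in a compact group.)
[cite: MochizukiEtTh2009, §0 p.9] -/
theorem isMinimalCofree_of_isCompact {C : Subgroup H} [C.Normal] (hC : IsCofree C)
    (hcpt : IsCompact (C : Set H)) : IsMinimalCofree C :=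
  ⟨hC, fun N hN hNc => @le_of_isCofree_of_isCompact H _ _ _ N hN hNc C hcpt⟩

/-- **Criterion, generated form** (the shape of print's `Δ^{fil,∞}_i`: the closed normal subgroup generated by
the compact decomposition groups of the irreducible components, with free quotient `π₁` of the dual graph):
a co-free subgroup `C` contained in the closure of the join of a family of COMPACT subgroups is the minimal
co-free subgroup — every co-free `N` contains each compact member, hence their join, hence (being open, so
closed) its closure, hence `C`. [cite: MochizukiEtTh2009, Def 3.3 (i)(b) p.72] -/
theorem isMinimalCofree_of_le_topologicalClosure_iSup {C : Subgroup H} [C.Normal] (hC : IsCofree C)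
    {ι : Sort*} (K : ι → Subgroup H) (hK : ∀ i, IsCompact (K i : Set H))
    (hgen : C ≤ (⨆ i, K i).topologicalClosure) : IsMinimalCofree C := by
  refine ⟨hC, fun N hN hNc => hgen.trans ?_⟩
  refine Subgroup.topologicalClosure_minimal _ (iSup_le fun i => ?_) (N.isClosed_of_isOpen hNc.isOpen)
  exact @le_of_isCofree_of_isCompact H _ _ _ N hN hNc (K i) (hK i)

end Criterion

/-! ### The model case `P × L`: compact times discrete free (the Tate-curve shape `Ẑ(1) × ℤ`) -/

section Product

variable (P : Type u) [Group P] [TopologicalSpace P] [IsTopologicalGroup P] [CompactSpace P]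
  (L : Type u) [Group L] [TopologicalSpace L] [DiscreteTopology L] [IsFreeGroup L]

omit [IsTopologicalGroup P] [CompactSpace P] in
/-- In `P × L` (`P` compact, `L` discrete free) the compact factor `P × {1}` is co-free: it is open (`{1}` is
open in `L`) and the quotient is `L`. [cite: MochizukiEtTh2009, §0 p.9] -/
theorem isCofree_prod_top_bot : IsCofree ((⊤ : Subgroup P).prod (⊥ : Subgroup L)) := by
  refine ⟨?_, ?_⟩
  · have : (((⊤ : Subgroup P).prod (⊥ : Subgroup L) : Subgroup (P × L)) : Set (P × L)) =
        (Set.univ : Set P) ×ˢ ({1} : Set L) := by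
      ext x
      simp [Subgroup.mem_prod, Subgroup.mem_bot]
    rw [this]
    exact isOpen_univ.prod (isOpen_discrete _)
  · exact IsFreeGroup.ofMulEquiv
      ((QuotientGroup.quotientKerEquivOfSurjective (MonoidHom.snd P L) Prod.snd_surjective).symm.trans
        (QuotientGroup.quotientMulEquivOfEq (MonoidHom.ker_snd (G := P) (G' := L))))

/-- **The Tate-curve shape**: in `P × L` with `P` COMPACT and `L` DISCRETE FREE, the minimal co-free subgroup
is the compact factor `P × {1}` — a proper, non-trivial instance of Def. 3.3 (i)(b)'s `Δ^{fil,∞}` (for the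
geometric tempered fundamental group `Ẑ(1) × ℤ` of a Tate curve: `Δ^{fil,∞}` = the profinite factor, the
quotient `ℤ = π₁` of the dual graph, a cycle; [EtTh] §1). [cite: MochizukiEtTh2009, Def 3.3 (i)(b) p.72] -/
theorem isMinimalCofree_prod_top_bot : IsMinimalCofree ((⊤ : Subgroup P).prod (⊥ : Subgroup L)) := by
  refine isMinimalCofree_of_isCompact (isCofree_prod_top_bot P L) ?_
  have : (((⊤ : Subgroup P).prod (⊥ : Subgroup L) : Subgroup (P × L)) : Set (P × L)) =
      (Set.univ : Set P) ×ˢ ({1} : Set L) := by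
    ext x
    simp [Subgroup.mem_prod, Subgroup.mem_bot]
  rw [this]
  exact isCompact_univ.prod isCompact_singleton

end Product

end Literature.AnabelianGeometry.EtaleTheta
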